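import Summits.CriticalPhenomena.PercolationContinuityZ3.Theorems.PercNearOneGluingNoHeavyQuantSubfloorTripleHub
import HarnessLib

/-!
# QUANT lane R8, T-DEC: SUB-FLOOR HUBS (part 3, the QUAD HUB) — four far-giant pieces `{1,3;γᵢ}` convolved are SDEC at the true floor
# (the all-far-giant core of FOUR glued children; still ONE positive low atom after any gate — the last width where one route per gate suffices)

builds on p205010 (kernel theorem, internal audit signed; external expert review pending)

Support file (`--supports stmt-CriticalPhenomena-4575`), QUANT lane seat prim-quant-census-1 (gen 30); memo
`run/shared/lean/prim/quant/prim-quant-census-1/g30/SUBFLOOR-HUBS-G30.md` §3 (2).  Theorems only (standard axioms, no sorries) over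
`…QuantSubfloorPairHub` / `…QuantSubfloorTripleHub` (this seat) and arm-1 g49's `decAt_all_of_budget_near` / `decAt_all_of_lowCeiling`.

THE PATTERN `j ≤ 4`.  For the `j`-fold sub-floor hub `δ_j ∗ Π blob₂(γᵢ)` the positive lows after an outer gate are the atoms `j + 2s` with
`s < j/4`: for `j ≤ 4` only the bottom atom is ever low, and ONE near route per gate certifies DEC at every layer (here `4 → 6` while
`T < 9`, `4 → 8` while `9 ≤ T < 11`, `4 → 10` when `T ≥ 11`).  The SDEC proof is done for an ABSTRACT one-low five-atom law
(`sdec_fiveAtom_oneLow`: masses `u₀..u₄`, six capacity inequalities) and instantiated with the elementary symmetric masses (`quadHub_keys`: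
termwise `x(1−γ) ≤ 4(1−x)γ ⟸ 3x ≤ 1+2γ, γ ≥ 1/6`; `e₀ ≤ e₁`, `3e₀ ≤ e₂`, `2e₀ ≤ e₃` from `γᵢ ≥ 1/2`).  Decls: `quadHub_eq_lconv`,
`quadHub_blob_ineq`, `quadHub_keys`, **`sdec_fiveAtom_oneLow`**, **`sdec_quadHub`**, **`sdec_quadHub_glued`** (four glued children's
all-far-giant core).  Exact census of the route rule: 400 quadruples × 16 gates, 0 failures (memo §3); the width-4 assembly is left open.
HONEST STATUS.  `SiblingStep` ⟺ `GateStepN`, `FarTreeRow` OPEN; RATE class (log\*) / honest sentence of `run/shared/lean/prim/quant/README.md`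
unchanged.  [this work].  Nothing here is cited as a published result.  The gluing rows served [cite: KozmaNitzan2024, Conjecture 3 (p. 15)];
product measure [cite: Grimmett1999, §1.3 p. 10].
-/

noncomputable section

open scoped BigOperators

namespace Summit.CriticalPhenomena.PercolationContinuityZ3.Theorems
namespace Quant
namespace LawDec

open Finset

/-- the FAR-GIANT PIECE `C(γ) = {1, 3; γ}` -/
local notation3 "CP[" a "]" => (fun h : ℕ => (1 - (a : ℝ)) * (if h = 1 then (1 : ℝ) else 0) + (a : ℝ) * (if h = 3 then (1 : ℝ) else 0))

/-- the TRIPLE HUB (as in `…QuantSubfloorTripleHub`) -/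
local notation3 "TH[" a ", " b ", " c "]" => (fun h : ℕ =>
  (1 - (a : ℝ)) * (1 - (b : ℝ)) * (1 - (c : ℝ)) * (if h = 3 then (1 : ℝ) else 0) +
  ((a : ℝ) * (1 - (b : ℝ)) * (1 - (c : ℝ)) + (1 - (a : ℝ)) * (b : ℝ) * (1 - (c : ℝ)) + (1 - (a : ℝ)) * (1 - (b : ℝ)) * (c : ℝ)) *
    (if h = 5 then (1 : ℝ) else 0) +
  ((a : ℝ) * (b : ℝ) * (1 - (c : ℝ)) + (a : ℝ) * (1 - (b : ℝ)) * (c : ℝ) + (1 - (a : ℝ)) * (b : ℝ) * (c : ℝ)) *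
    (if h = 7 then (1 : ℝ) else 0) +
  (a : ℝ) * (b : ℝ) * (c : ℝ) * (if h = 9 then (1 : ℝ) else 0))

/-- the QUAD HUB `C(γ₁) ∗ C(γ₂) ∗ C(γ₃) ∗ C(γ₄)`: four sure relays ⊕ four independent 2-blobs (atoms `4,6,8,10,12`, coefficients the
elementary symmetric functions of the blob indicators) -/
local notation3 "QH[" a ", " b ", " c ", " d "]" => (fun h : ℕ =>
  ((1 - (a : ℝ)) * (1 - (b : ℝ)) * (1 - (c : ℝ)) * (1 - (d : ℝ))) * (if h = 4 then (1 : ℝ) else 0) +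
  ((a : ℝ) * (1 - (b : ℝ)) * (1 - (c : ℝ)) * (1 - (d : ℝ)) + (1 - (a : ℝ)) * (b : ℝ) * (1 - (c : ℝ)) * (1 - (d : ℝ)) + (1 - (a : ℝ)) * (1 - (b : ℝ)) * (c : ℝ) * (1 - (d : ℝ)) + (1 - (a : ℝ)) * (1 - (b : ℝ)) * (1 - (c : ℝ)) * (d : ℝ)) * (if h = 6 then (1 : ℝ) else 0) +
  ((a : ℝ) * (b : ℝ) * (1 - (c : ℝ)) * (1 - (d : ℝ)) + (a : ℝ) * (1 - (b : ℝ)) * (c : ℝ) * (1 - (d : ℝ)) + (a : ℝ) * (1 - (b : ℝ)) * (1 - (c : ℝ)) * (d : ℝ) + (1 - (a : ℝ)) * (b : ℝ) * (c : ℝ) * (1 - (d : ℝ)) + (1 - (a : ℝ)) * (b : ℝ) * (1 - (c : ℝ)) * (d : ℝ) + (1 - (a : ℝ)) * (1 - (b : ℝ)) * (c : ℝ) * (d : ℝ)) * (if h = 8 then (1 : ℝ) else 0) +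
  ((a : ℝ) * (b : ℝ) * (c : ℝ) * (1 - (d : ℝ)) + (a : ℝ) * (b : ℝ) * (1 - (c : ℝ)) * (d : ℝ) + (a : ℝ) * (1 - (b : ℝ)) * (c : ℝ) * (d : ℝ) + (1 - (a : ℝ)) * (b : ℝ) * (c : ℝ) * (d : ℝ)) * (if h = 10 then (1 : ℝ) else 0) +
  ((a : ℝ) * (b : ℝ) * (c : ℝ) * (d : ℝ)) * (if h = 12 then (1 : ℝ) else 0))

/-- a law on the atoms `4, 6, 8, 10, 12` with masses `u₀ … u₄` (the quad hub has `uₛ = eₛ(γ)`) -/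
local notation3 "FV[" u0 ", " u1 ", " u2 ", " u3 ", " u4 "]" => (fun h : ℕ =>
  (u0 : ℝ) * (if h = 4 then (1 : ℝ) else 0) + (u1 : ℝ) * (if h = 6 then (1 : ℝ) else 0) + (u2 : ℝ) * (if h = 8 then (1 : ℝ) else 0) +
  (u3 : ℝ) * (if h = 10 then (1 : ℝ) else 0) + (u4 : ℝ) * (if h = 12 then (1 : ℝ) else 0))

/-- the quad hub is the triple hub convolved with a fourth far-giant piece. [this work] -/
theorem quadHub_eq_lconv (γ₁ γ₂ γ₃ γ₄ : ℝ) : lconv 9 3 TH[γ₁, γ₂, γ₃] CP[γ₄] = QH[γ₁, γ₂, γ₃, γ₄] := by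
  funext h
  simp only [lconv, Finset.sum_range_succ, Finset.sum_range_zero]
  rcases Nat.lt_or_ge h 13 with hh | hh
  · interval_cases h
    all_goals norm_num
    all_goals ring
  · simp [show h ≠ 4 by omega, show h ≠ 6 by omega, show h ≠ 8 by omega, show h ≠ 10 by omega, show h ≠ 12 by omega,
      show (4 : ℕ) ≠ h by omega, show (6 : ℕ) ≠ h by omega, show (8 : ℕ) ≠ h by omega, show (10 : ℕ) ≠ h by omega, show (12 : ℕ) ≠ h by omega]

/-- the per-blob inequality behind the quad hub: `3x ≤ 1 + 2γ`, `1/6 ≤ γ ≤ 1` ⟹ `x(1−γ) ≤ 4(1−x)γ`. [this work] -/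
theorem quadHub_blob_ineq {x γ : ℝ} (hγ : 1 / 6 ≤ γ) (hγ1 : γ ≤ 1) (hx : 3 * x ≤ 1 + 2 * γ) : x * (1 - γ) ≤ 4 * (1 - x) * γ := by
  nlinarith [mul_nonneg (show (0 : ℝ) ≤ 1 + 3 * γ by linarith) (show (0 : ℝ) ≤ 1 + 2 * γ - 3 * x by linarith),
    mul_nonneg (show (0 : ℝ) ≤ 6 * γ - 1 by linarith) (show (0 : ℝ) ≤ 1 - γ by linarith)]

/-- capacity inequalities of the quad hub: `x(e₀+e₁) ≤ e₁`, `e₀ ≤ e₁`, `x(e₀+e₂) ≤ e₂`, `3e₀ ≤ e₂`, `x(e₀+e₃) ≤ e₃`, `2e₀ ≤ e₃`. [this work] -/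
theorem quadHub_keys {x γ₁ γ₂ γ₃ γ₄ : ℝ} (h₁ : 1 / 2 ≤ γ₁) (h₁' : γ₁ ≤ 1) (h₂ : 1 / 2 ≤ γ₂) (h₂' : γ₂ ≤ 1) (h₃ : 1 / 2 ≤ γ₃) (h₃' : γ₃ ≤ 1)
    (h₄ : 1 / 2 ≤ γ₄) (h₄' : γ₄ ≤ 1) (hx₁ : 3 * x ≤ 1 + 2 * γ₁) (hx₂ : 3 * x ≤ 1 + 2 * γ₂) (hx₃ : 3 * x ≤ 1 + 2 * γ₃) (hx₄ : 3 * x ≤ 1 + 2 * γ₄) :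
    (x * (((1 - γ₁) * (1 - γ₂) * (1 - γ₃) * (1 - γ₄)) + (γ₁ * (1 - γ₂) * (1 - γ₃) * (1 - γ₄) + (1 - γ₁) * γ₂ * (1 - γ₃) * (1 - γ₄) + (1 - γ₁) * (1 - γ₂) * γ₃ * (1 - γ₄) + (1 - γ₁) * (1 - γ₂) * (1 - γ₃) * γ₄)) ≤ γ₁ * (1 - γ₂) * (1 - γ₃) * (1 - γ₄) + (1 - γ₁) * γ₂ * (1 - γ₃) * (1 - γ₄) + (1 - γ₁) * (1 - γ₂) * γ₃ * (1 - γ₄) + (1 - γ₁) * (1 - γ₂) * (1 - γ₃) * γ₄) ∧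
    ((1 - γ₁) * (1 - γ₂) * (1 - γ₃) * (1 - γ₄) ≤ γ₁ * (1 - γ₂) * (1 - γ₃) * (1 - γ₄) + (1 - γ₁) * γ₂ * (1 - γ₃) * (1 - γ₄) + (1 - γ₁) * (1 - γ₂) * γ₃ * (1 - γ₄) + (1 - γ₁) * (1 - γ₂) * (1 - γ₃) * γ₄) ∧
    (x * (((1 - γ₁) * (1 - γ₂) * (1 - γ₃) * (1 - γ₄)) + (γ₁ * γ₂ * (1 - γ₃) * (1 - γ₄) + γ₁ * (1 - γ₂) * γ₃ * (1 - γ₄) + γ₁ * (1 - γ₂) * (1 - γ₃) * γ₄ + (1 - γ₁) * γ₂ * γ₃ * (1 - γ₄) + (1 - γ₁) * γ₂ * (1 - γ₃) * γ₄ + (1 - γ₁) * (1 - γ₂) * γ₃ * γ₄)) ≤ γ₁ * γ₂ * (1 - γ₃) * (1 - γ₄) + γ₁ * (1 - γ₂) * γ₃ * (1 - γ₄) + γ₁ * (1 - γ₂) * (1 - γ₃) * γ₄ + (1 - γ₁) * γ₂ * γ₃ * (1 - γ₄) + (1 - γ₁) * γ₂ * (1 - γ₃) * γ₄ + (1 -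 γ₁) * (1 - γ₂) * γ₃ * γ₄) ∧
    (3 * ((1 - γ₁) * (1 - γ₂) * (1 - γ₃) * (1 - γ₄)) ≤ γ₁ * γ₂ * (1 - γ₃) * (1 - γ₄) + γ₁ * (1 - γ₂) * γ₃ * (1 - γ₄) + γ₁ * (1 - γ₂) * (1 - γ₃) * γ₄ + (1 - γ₁) * γ₂ * γ₃ * (1 - γ₄) + (1 - γ₁) * γ₂ * (1 - γ₃) * γ₄ + (1 - γ₁) * (1 - γ₂) * γ₃ * γ₄) ∧
    (x * (((1 - γ₁) * (1 - γ₂) * (1 - γ₃) * (1 - γ₄)) + (γ₁ * γ₂ * γ₃ * (1 - γ₄) + γ₁ * γ₂ * (1 - γ₃) * γ₄ + γ₁ * (1 - γ₂) * γ₃ * γ₄ + (1 - γ₁) * γ₂ * γ₃ * γ₄)) ≤ γ₁ * γ₂ * γ₃ * (1 - γ₄) + γ₁ * γ₂ * (1 - γ₃) * γ₄ + γ₁ * (1 - γ₂) * γ₃ * γ₄ + (1 - γ₁) * γ₂ * γ₃ * γ₄) ∧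
    (2 * ((1 - γ₁) * (1 - γ₂) * (1 - γ₃) * (1 - γ₄)) ≤ γ₁ * γ₂ * γ₃ * (1 - γ₄) + γ₁ * γ₂ * (1 - γ₃) * γ₄ + γ₁ * (1 - γ₂) * γ₃ * γ₄ + (1 - γ₁) * γ₂ * γ₃ * γ₄) := by
  have n₁ : (0 : ℝ) ≤ 1 - γ₁ := by linarith
  have n₂ : (0 : ℝ) ≤ 1 - γ₂ := by linarith
  have n₃ : (0 : ℝ) ≤ 1 - γ₃ := by linarith
  have n₄ : (0 : ℝ) ≤ 1 - γ₄ := by linarith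
  have p₁ : (0 : ℝ) ≤ γ₁ := by linarith
  have p₂ : (0 : ℝ) ≤ γ₂ := by linarith
  have p₃ : (0 : ℝ) ≤ γ₃ := by linarith
  have p₄ : (0 : ℝ) ≤ γ₄ := by linarith
  have hx1 : x ≤ 1 := by linarith
  have t₁ : 0 ≤ 4 * (1 - x) * γ₁ - x * (1 - γ₁) := by linarith [quadHub_blob_ineq (by linarith) h₁' hx₁]
  have t₂ : 0 ≤ 4 * (1 - x) * γ₂ - x * (1 - γ₂) := by linarith [quadHub_blob_ineq (by linarith) h₂' hx₂]
  have t₃ : 0 ≤ 4 * (1 - x) * γ₃ - x * (1 - γ₃) := by linarith [quadHub_blob_ineq (by linarith) h₃' hx₃]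
  have t₄ : 0 ≤ 4 * (1 - x) * γ₄ - x * (1 - γ₄) := by linarith [quadHub_blob_ineq (by linarith) h₄' hx₄]
  have d₁ : (0 : ℝ) ≤ 2 * γ₁ - 1 := by linarith
  have d₂ : (0 : ℝ) ≤ 2 * γ₂ - 1 := by linarith
  have d₃ : (0 : ℝ) ≤ 2 * γ₃ - 1 := by linarith
  have d₄ : (0 : ℝ) ≤ 2 * γ₄ - 1 := by linarith
  have e0n : 0 ≤ (1 - γ₁) * (1 - γ₂) * (1 - γ₃) * (1 - γ₄) := by positivity
  have hx1' : (0 : ℝ) ≤ 1 - x := by linarith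
  have hx0' : (0 : ℝ) ≤ x ∨ x < 0 := le_or_gt 0 x
  refine ⟨?_, ?_, ?_, ?_, ?_, ?_⟩
  · linarith [mul_nonneg (mul_nonneg (mul_nonneg n₂ n₃) n₄) t₁, mul_nonneg (mul_nonneg (mul_nonneg n₁ n₃) n₄) t₂,
      mul_nonneg (mul_nonneg (mul_nonneg n₁ n₂) n₄) t₃, mul_nonneg (mul_nonneg (mul_nonneg n₁ n₂) n₃) t₄]
  · linarith [mul_nonneg (mul_nonneg (mul_nonneg d₁ n₂) n₃) n₄, mul_nonneg (mul_nonneg (mul_nonneg n₁ p₂) n₃) n₄,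
      mul_nonneg (mul_nonneg (mul_nonneg n₁ n₂) p₃) n₄, mul_nonneg (mul_nonneg (mul_nonneg n₁ n₂) n₃) p₄]
  · -- pairs: x(1−γᵢ)(1−γₖ) ≤ 4(1−x)γᵢγₖ
    have u₁₂ : 0 ≤ 4 * (1 - x) * γ₁ * γ₂ - x * (1 - γ₁) * (1 - γ₂) := by
      linarith [mul_nonneg n₂ t₁, mul_nonneg (mul_nonneg hx1' p₁) d₂]
    have u₁₃ : 0 ≤ 4 * (1 - x) * γ₁ * γ₃ - x * (1 - γ₁) * (1 - γ₃) := by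
      linarith [mul_nonneg n₃ t₁, mul_nonneg (mul_nonneg hx1' p₁) d₃]
    have u₁₄ : 0 ≤ 4 * (1 - x) * γ₁ * γ₄ - x * (1 - γ₁) * (1 - γ₄) := by
      linarith [mul_nonneg n₄ t₁, mul_nonneg (mul_nonneg hx1' p₁) d₄]
    have u₂₃ : 0 ≤ 4 * (1 - x) * γ₂ * γ₃ - x * (1 - γ₂) * (1 - γ₃) := by
      linarith [mul_nonneg n₃ t₂, mul_nonneg (mul_nonneg hx1' p₂) d₃]
    have u₂₄ : 0 ≤ 4 * (1 - x) * γ₂ * γ₄ - x * (1 - γ₂) * (1 - γ₄) := by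
      linarith [mul_nonneg n₄ t₂, mul_nonneg (mul_nonneg hx1' p₂) d₄]
    have u₃₄ : 0 ≤ 4 * (1 - x) * γ₃ * γ₄ - x * (1 - γ₃) * (1 - γ₄) := by
      linarith [mul_nonneg n₄ t₃, mul_nonneg (mul_nonneg hx1' p₃) d₄]
    have e2n : 0 ≤ γ₁ * γ₂ * (1 - γ₃) * (1 - γ₄) + γ₁ * (1 - γ₂) * γ₃ * (1 - γ₄) + γ₁ * (1 - γ₂) * (1 - γ₃) * γ₄ +
        (1 - γ₁) * γ₂ * γ₃ * (1 - γ₄) + (1 - γ₁) * γ₂ * (1 - γ₃) * γ₄ + (1 - γ₁) * (1 - γ₂) * γ₃ * γ₄ := by positivity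
    rcases hx0' with hx0 | hx0
    · linarith [mul_nonneg (mul_nonneg n₃ n₄) u₁₂, mul_nonneg (mul_nonneg n₂ n₄) u₁₃, mul_nonneg (mul_nonneg n₂ n₃) u₁₄,
        mul_nonneg (mul_nonneg n₁ n₄) u₂₃, mul_nonneg (mul_nonneg n₁ n₃) u₂₄, mul_nonneg (mul_nonneg n₁ n₂) u₃₄,
        mul_nonneg hx1' e2n, mul_nonneg hx0 e0n]
    · have : x * ((1 - γ₁) * (1 - γ₂) * (1 - γ₃) * (1 - γ₄) + (γ₁ * γ₂ * (1 - γ₃) * (1 - γ₄) + γ₁ * (1 - γ₂) * γ₃ * (1 - γ₄) +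
          γ₁ * (1 - γ₂) * (1 - γ₃) * γ₄ + (1 - γ₁) * γ₂ * γ₃ * (1 - γ₄) + (1 - γ₁) * γ₂ * (1 - γ₃) * γ₄ + (1 - γ₁) * (1 - γ₂) * γ₃ * γ₄)) ≤ 0 :=
        mul_nonpos_of_nonpos_of_nonneg hx0.le (by linarith)
      linarith
  · have w₁₂ : 0 ≤ γ₁ * γ₂ - (1 - γ₁) * (1 - γ₂) := by linarith
    have w₁₃ : 0 ≤ γ₁ * γ₃ - (1 - γ₁) * (1 - γ₃) := by linarith
    have w₁₄ : 0 ≤ γ₁ * γ₄ - (1 - γ₁) * (1 - γ₄) := by linarith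
    have w₂₃ : 0 ≤ γ₂ * γ₃ - (1 - γ₂) * (1 - γ₃) := by linarith
    have w₂₄ : 0 ≤ γ₂ * γ₄ - (1 - γ₂) * (1 - γ₄) := by linarith
    have w₃₄ : 0 ≤ γ₃ * γ₄ - (1 - γ₃) * (1 - γ₄) := by linarith
    linarith [mul_nonneg (mul_nonneg n₃ n₄) w₁₂, mul_nonneg (mul_nonneg n₂ n₄) w₁₃, mul_nonneg (mul_nonneg n₂ n₃) w₁₄,
      mul_nonneg (mul_nonneg n₁ n₄) w₂₃, mul_nonneg (mul_nonneg n₁ n₃) w₂₄, mul_nonneg (mul_nonneg n₁ n₂) w₃₄, e0n]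
  · -- triples: x(1−γᵢ)(1−γₖ)(1−γₗ) ≤ 4(1−x)γᵢγₖγₗ
    have u₁₂ : 0 ≤ 4 * (1 - x) * γ₁ * γ₂ - x * (1 - γ₁) * (1 - γ₂) := by
      linarith [mul_nonneg n₂ t₁, mul_nonneg (mul_nonneg hx1' p₁) d₂]
    have v₁₂₃ : 0 ≤ 4 * (1 - x) * γ₁ * γ₂ * γ₃ - x * (1 - γ₁) * (1 - γ₂) * (1 - γ₃) := by
      linarith [mul_nonneg n₃ u₁₂, mul_nonneg (mul_nonneg (mul_nonneg hx1' p₁) p₂) d₃]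
    have v₁₂₄ : 0 ≤ 4 * (1 - x) * γ₁ * γ₂ * γ₄ - x * (1 - γ₁) * (1 - γ₂) * (1 - γ₄) := by
      linarith [mul_nonneg n₄ u₁₂, mul_nonneg (mul_nonneg (mul_nonneg hx1' p₁) p₂) d₄]
    have u₁₃ : 0 ≤ 4 * (1 - x) * γ₁ * γ₃ - x * (1 - γ₁) * (1 - γ₃) := by
      linarith [mul_nonneg n₃ t₁, mul_nonneg (mul_nonneg hx1' p₁) d₃]
    have v₁₃₄ : 0 ≤ 4 * (1 - x) * γ₁ * γ₃ * γ₄ - x * (1 - γ₁) * (1 - γ₃) * (1 - γ₄) := by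
      linarith [mul_nonneg n₄ u₁₃, mul_nonneg (mul_nonneg (mul_nonneg hx1' p₁) p₃) d₄]
    have u₂₃ : 0 ≤ 4 * (1 - x) * γ₂ * γ₃ - x * (1 - γ₂) * (1 - γ₃) := by
      linarith [mul_nonneg n₃ t₂, mul_nonneg (mul_nonneg hx1' p₂) d₃]
    have v₂₃₄ : 0 ≤ 4 * (1 - x) * γ₂ * γ₃ * γ₄ - x * (1 - γ₂) * (1 - γ₃) * (1 - γ₄) := by
      linarith [mul_nonneg n₄ u₂₃, mul_nonneg (mul_nonneg (mul_nonneg hx1' p₂) p₃) d₄]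
    linarith [mul_nonneg n₄ v₁₂₃, mul_nonneg n₃ v₁₂₄, mul_nonneg n₂ v₁₃₄, mul_nonneg n₁ v₂₃₄]
  · have w₁₂₃ : 0 ≤ γ₁ * γ₂ * γ₃ - (1 - γ₁) * (1 - γ₂) * (1 - γ₃) := by
      linarith [mul_nonneg (mul_nonneg n₁ n₂) d₃, mul_nonneg (mul_nonneg n₁ d₂) p₃, mul_nonneg (mul_nonneg d₁ p₂) p₃]
    have w₁₂₄ : 0 ≤ γ₁ * γ₂ * γ₄ - (1 - γ₁) * (1 - γ₂) * (1 - γ₄) := by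
      linarith [mul_nonneg (mul_nonneg n₁ n₂) d₄, mul_nonneg (mul_nonneg n₁ d₂) p₄, mul_nonneg (mul_nonneg d₁ p₂) p₄]
    have w₁₃₄ : 0 ≤ γ₁ * γ₃ * γ₄ - (1 - γ₁) * (1 - γ₃) * (1 - γ₄) := by
      linarith [mul_nonneg (mul_nonneg n₁ n₃) d₄, mul_nonneg (mul_nonneg n₁ d₃) p₄, mul_nonneg (mul_nonneg d₁ p₃) p₄]
    have w₂₃₄ : 0 ≤ γ₂ * γ₃ * γ₄ - (1 - γ₂) * (1 - γ₃) * (1 - γ₄) := by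
      linarith [mul_nonneg (mul_nonneg n₂ n₃) d₄, mul_nonneg (mul_nonneg n₂ d₃) p₄, mul_nonneg (mul_nonneg d₂ p₃) p₄]
    linarith [mul_nonneg n₄ w₁₂₃, mul_nonneg n₃ w₁₂₄, mul_nonneg n₂ w₁₃₄, mul_nonneg n₁ w₂₃₄, e0n]

/-- **A ONE-LOW FIVE-ATOM LAW IS SDEC.**  For a law `{4: u₀, 6: u₁, 8: u₂, 10: u₃, 12: u₄}` (`uₛ ≥ 0`, `Σ uₛ = 1`, mean `m < 12`, `12x ≤ m`,
`0 < x < 1`) satisfying the six capacity inequalities `x(u₀+u₁) ≤ u₁`, `u₀ ≤ u₁`, `x(u₀+u₂) ≤ u₂`, `3u₀ ≤ u₂`, `x(u₀+u₃) ≤ u₃`, `2u₀ ≤ u₃`: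
`SDEC x 12`.  The only positive low atom after an outer gate is `4` (when `T > 8`), shipped by ONE near route: `4 → 6` while `T < 9`,
`4 → 8` while `9 ≤ T < 11`, `4 → 10` when `T ≥ 11`. [this work] -/
theorem sdec_fiveAtom_oneLow {x u₀ u₁ u₂ u₃ u₄ : ℝ} (hx0 : 0 < x) (hx1 : x < 1) (e0n : 0 ≤ u₀) (_e1n : 0 ≤ u₁) (_e2n : 0 ≤ u₂)
    (_e3n : 0 ≤ u₃) (e4n : 0 ≤ u₄) (hsum : u₀ + u₁ + u₂ + u₃ + u₄ = 1) (hm12 : 4 * u₀ + 6 * u₁ + 8 * u₂ + 10 * u₃ + 12 * u₄ < 12)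
    (h12x : 12 * x ≤ 4 * u₀ + 6 * u₁ + 8 * u₂ + 10 * u₃ + 12 * u₄)
    (key1 : x * (u₀ + u₁) ≤ u₁) (key2 : u₀ ≤ u₁) (key3 : x * (u₀ + u₂) ≤ u₂) (key4 : 3 * u₀ ≤ u₂) (key5 : x * (u₀ + u₃) ≤ u₃)
    (key6 : 2 * u₀ ≤ u₃) :
    SDEC x 12 FV[u₀, u₁, u₂, u₃, u₄] := by
  have l0 : ∀ h, 0 ≤ FV[u₀, u₁, u₂, u₃, u₄] h := by
    intro h; dsimp only; split_ifs <;> linarith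
  have lM : ∀ h, 12 < h → FV[u₀, u₁, u₂, u₃, u₄] h = 0 := by
    intro h hh; dsimp only
    rw [if_neg (by omega), if_neg (by omega), if_neg (by omega), if_neg (by omega), if_neg (by omega)]; ring
  have l1 : ∑ h ∈ Finset.range (12 + 1), FV[u₀, u₁, u₂, u₃, u₄] h = 1 := by
    simp [Finset.sum_range_succ]; linarith
  have lmean : ∑ h ∈ Finset.range (12 + 1), (h : ℝ) * FV[u₀, u₁, u₂, u₃, u₄] h = (4 * u₀ + 6 * u₁ + 8 * u₂ + 10 * u₃ + 12 * u₄) := by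
    simp [Finset.sum_range_succ]
  intro a ha0 ha1 j' hj'
  obtain ⟨g0, gM, g1⟩ := gate_laws 12 FV[u₀, u₁, u₂, u₃, u₄] a ha0.le ha1 l0 lM l1
  have gmean : ∑ h ∈ Finset.range (12 + 1), (h : ℝ) * gate FV[u₀, u₁, u₂, u₃, u₄] a h = a * ((4 * u₀ + 6 * u₁ + 8 * u₂ + 10 * u₃ + 12 * u₄)) := by
    rw [sum_mul_gate, lmean]
  set T : ℝ := a * ((4 * u₀ + 6 * u₁ + 8 * u₂ + 10 * u₃ + 12 * u₄)) with hT
  have hax0 : 0 < a * x := mul_pos ha0 hx0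
  have haxx : a * x ≤ x := by
    have := mul_le_mul_of_nonneg_right ha1 hx0.le
    linarith
  have hax1 : a * x < 1 := by linarith
  have hmpos : 0 < 4 * u₀ + 6 * u₁ + 8 * u₂ + 10 * u₃ + 12 * u₄ := by linarith
  have hT0 : 0 < T := by rw [hT]; positivity
  have hTle : T ≤ (4 * u₀ + 6 * u₁ + 8 * u₂ + 10 * u₃ + 12 * u₄) := by
    have := mul_le_mul_of_nonneg_right ha1 (show (0 : ℝ) ≤ (4 * u₀ + 6 * u₁ + 8 * u₂ + 10 * u₃ + 12 * u₄) by positivity)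
    linarith
  have hT12 : T < 12 := by linarith
  have hta : a * x * ((12 : ℕ) : ℝ) ≤ T := by
    have := mul_le_mul_of_nonneg_left h12x ha0.le
    push_cast; linarith
  have v1 : gate FV[u₀, u₁, u₂, u₃, u₄] a 1 = 0 := by rw [gate_apply]; norm_num
  have v2 : gate FV[u₀, u₁, u₂, u₃, u₄] a 2 = 0 := by rw [gate_apply]; norm_num
  have v3 : gate FV[u₀, u₁, u₂, u₃, u₄] a 3 = 0 := by rw [gate_apply]; norm_num
  have v5 : gate FV[u₀, u₁, u₂, u₃, u₄] a 5 = 0 := by rw [gate_apply]; norm_num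
  have v4 : gate FV[u₀, u₁, u₂, u₃, u₄] a 4 = a * u₀ := by rw [gate_apply]; norm_num
  have v6 : gate FV[u₀, u₁, u₂, u₃, u₄] a 6 = a * u₁ := by rw [gate_apply]; norm_num
  have v8 : gate FV[u₀, u₁, u₂, u₃, u₄] a 8 = a * u₂ := by rw [gate_apply]; norm_num
  have v10 : gate FV[u₀, u₁, u₂, u₃, u₄] a 10 = a * u₃ := by rw [gate_apply]; norm_num
  by_cases hT8 : 8 < T
  ·
    obtain ⟨t, ht, htT, hTt, hcapt⟩ : ∃ t : ℕ, (t = 6 ∨ t = 8 ∨ t = 10) ∧ ((t : ℝ) ≤ T) ∧ (T < 4 + (t : ℝ)) ∧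
        max (a * x) ((T - 2 * ((4 : ℕ) : ℝ)) / ((t : ℝ) - ((4 : ℕ) : ℝ))) *
          (gate FV[u₀, u₁, u₂, u₃, u₄] a 4 + gate FV[u₀, u₁, u₂, u₃, u₄] a t) ≤ gate FV[u₀, u₁, u₂, u₃, u₄] a t := by
      by_cases hT9 : T < 9
      · refine ⟨6, Or.inl rfl, by push_cast; linarith, by push_cast; linarith, ?_⟩
        have eθ : (T - 2 * ((4 : ℕ) : ℝ)) / (((6 : ℕ) : ℝ) - ((4 : ℕ) : ℝ)) = (T - 8) / 2 := by norm_num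
        rw [eθ, v4, v6]
        have e0 : 0 ≤ u₀ + u₁ := by linarith
        rcases le_total (a * x) ((T - 8) / 2) with hle | hle
        · rw [max_eq_right hle]
          have hb : (T - 8) / 2 ≤ 1 / 2 := by linarith
          have h1 := mul_le_mul_of_nonneg_right hb e0
          have h2 : (1 : ℝ) / 2 * (u₀ + u₁) ≤ u₁ := by linarith
          have h3 := mul_le_mul_of_nonneg_left (h1.trans h2) ha0.le
          have e : (T - 8) / 2 * (a * u₀ + a * u₁) = a * ((T - 8) / 2 * (u₀ + u₁)) := by ring
          rw [e]; exact h3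
        · rw [max_eq_left hle]
          have h1 := mul_le_mul_of_nonneg_right haxx e0
          have h3 := mul_le_mul_of_nonneg_left (h1.trans key1) ha0.le
          have e : a * x * (a * u₀ + a * u₁) = a * (a * x * (u₀ + u₁)) := by ring
          rw [e]; exact h3
      · by_cases hT11 : T < 11
        · have hT9' : 9 ≤ T := le_of_not_gt hT9
          refine ⟨8, Or.inr (Or.inl rfl), by push_cast; linarith, by push_cast; linarith, ?_⟩
          have eθ : (T - 2 * ((4 : ℕ) : ℝ)) / (((8 : ℕ) : ℝ) - ((4 : ℕ) : ℝ)) = (T - 8) / 4 := by norm_num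
          rw [eθ, v4, v8]
          have e0 : 0 ≤ u₀ + u₂ := by linarith
          rcases le_total (a * x) ((T - 8) / 4) with hle | hle
          · rw [max_eq_right hle]
            have hb : (T - 8) / 4 ≤ 3 / 4 := by linarith
            have h1 := mul_le_mul_of_nonneg_right hb e0
            have h2 : (3 : ℝ) / 4 * (u₀ + u₂) ≤ u₂ := by linarith
            have h3 := mul_le_mul_of_nonneg_left (h1.trans h2) ha0.le
            have e : (T - 8) / 4 * (a * u₀ + a * u₂) = a * ((T - 8) / 4 * (u₀ + u₂)) := by ring
            rw [e]; exact h3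
          · rw [max_eq_left hle]
            have h1 := mul_le_mul_of_nonneg_right haxx e0
            have h3 := mul_le_mul_of_nonneg_left (h1.trans key3) ha0.le
            have e : a * x * (a * u₀ + a * u₂) = a * (a * x * (u₀ + u₂)) := by ring
            rw [e]; exact h3
        · have hT11' : 11 ≤ T := le_of_not_gt hT11
          refine ⟨10, Or.inr (Or.inr rfl), by push_cast; linarith, by push_cast; linarith, ?_⟩
          have eθ : (T - 2 * ((4 : ℕ) : ℝ)) / (((10 : ℕ) : ℝ) - ((4 : ℕ) : ℝ)) = (T - 8) / 6 := by norm_num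
          rw [eθ, v4, v10]
          have e0 : 0 ≤ u₀ + u₃ := by linarith
          rcases le_total (a * x) ((T - 8) / 6) with hle | hle
          · rw [max_eq_right hle]
            have hb : (T - 8) / 6 ≤ 2 / 3 := by linarith
            have h1 := mul_le_mul_of_nonneg_right hb e0
            have h2 : (2 : ℝ) / 3 * (u₀ + u₃) ≤ u₃ := by linarith
            have h3 := mul_le_mul_of_nonneg_left (h1.trans h2) ha0.le
            have e : (T - 8) / 6 * (a * u₀ + a * u₃) = a * ((T - 8) / 6 * (u₀ + u₃)) := by ring
            rw [e]; exact h3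
          · rw [max_eq_left hle]
            have h1 := mul_le_mul_of_nonneg_right haxx e0
            have h3 := mul_le_mul_of_nonneg_left (h1.trans key5) ha0.le
            have e : a * x * (a * u₀ + a * u₃) = a * (a * x * (u₀ + u₃)) := by ring
            rw [e]; exact h3
    have ht12 : t ≤ 12 := by rcases ht with rfl | rfl | rfl <;> norm_num
    have htmem : t ∈ Finset.range (12 + 1) := Finset.mem_range.2 (by omega)
    have hθ1 : max (a * x) ((T - 2 * ((4 : ℕ) : ℝ)) / ((t : ℝ) - ((4 : ℕ) : ℝ))) < 1 := by
      refine max_lt hax1 ?_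
      have h8 : T < 4 + (t : ℝ) := hTt
      rcases ht with rfl | rfl | rfl
      · rw [show (T - 2 * ((4 : ℕ) : ℝ)) / (((6 : ℕ) : ℝ) - ((4 : ℕ) : ℝ)) = (T - 8) / 2 by norm_num]; push_cast at h8; linarith
      · rw [show (T - 2 * ((4 : ℕ) : ℝ)) / (((8 : ℕ) : ℝ) - ((4 : ℕ) : ℝ)) = (T - 8) / 4 by norm_num]; push_cast at h8; linarith
      · rw [show (T - 2 * ((4 : ℕ) : ℝ)) / (((10 : ℕ) : ℝ) - ((4 : ℕ) : ℝ)) = (T - 8) / 6 by norm_num]; push_cast at h8; linarith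
    have row4 : ∑ h ∈ Finset.range (12 + 1), (if 4 = 4 ∧ h = t then gate FV[u₀, u₁, u₂, u₃, u₄] a 4 else 0) = gate FV[u₀, u₁, u₂, u₃, u₄] a 4 := by
      rw [Finset.sum_eq_single_of_mem t htmem (fun h _ hh => by simp [hh])]
      simp
    have rowz : ∀ l : ℕ, l ≠ 4 → ∑ h ∈ Finset.range (12 + 1), (if l = 4 ∧ h = t then gate FV[u₀, u₁, u₂, u₃, u₄] a 4 else 0) = 0 := by
      intro l hl; exact Finset.sum_eq_zero fun h _ => by simp [hl]
    refine decAt_all_of_budget_near (a * x) 12 12 (gate FV[u₀, u₁, u₂, u₃, u₄] a)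
      (fun l h => if l = 4 ∧ h = t then gate FV[u₀, u₁, u₂, u₃, u₄] a 4 else 0) T hax0 hax1 g0 gM g1 gmean hT0 hta ?_ ?_ ?_ ?_ ?_ ?_ j' hj'
    · intro l h; split_ifs
      · exact g0 4
      · exact le_rfl
    · intro l h hlh
      split_ifs at hlh with hc
      · obtain ⟨rfl, rfl⟩ := hc
        refine ⟨by norm_num, by push_cast; linarith, by omega, ht12, by push_cast; linarith, htT⟩
      · exact absurd hlh (lt_irrefl _)
    · intro l
      by_cases hl : l = 4
      · subst hl; rw [row4]
      · rw [rowz l hl]; exact g0 l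
    · intro h
      by_cases hh : h = t
      · subst hh
        rw [Finset.sum_eq_single_of_mem 4 (by simp) (fun l _ hl => by simp [hl])]
        simp only [true_and, if_true]
        exact rate_mul_le_of_theta hθ1 hcapt (g0 4)
      · rw [Finset.sum_eq_zero (fun l _ => by simp [hh])]
        exact g0 h
    · intro l hl hlow hlt
      exfalso
      have hl6 : l < 6 := by
        have : (l : ℝ) < 6 := by
          have : (2 : ℝ) * l < 12 := lt_trans hlow hT12
          linarith
        exact_mod_cast this
      interval_cases l
      · rw [v1, rowz 1 (by norm_num)] at hlt; exact lt_irrefl _ hlt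
      · rw [v2, rowz 2 (by norm_num)] at hlt; exact lt_irrefl _ hlt
      · rw [v3, rowz 3 (by norm_num)] at hlt; exact lt_irrefl _ hlt
      · rw [row4] at hlt; exact lt_irrefl _ hlt
      · rw [v5, rowz 5 (by norm_num)] at hlt; exact lt_irrefl _ hlt
    · have hL : ∑ l ∈ Finset.range (12 + 1), (if (1 ≤ l ∧ 2 * (l : ℝ) < T) then
          (gate FV[u₀, u₁, u₂, u₃, u₄] a l - ∑ h ∈ Finset.range (12 + 1), (if l = 4 ∧ h = t then gate FV[u₀, u₁, u₂, u₃, u₄] a 4 else 0)) * (T - l)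
          else 0) = 0 := by
        refine Finset.sum_eq_zero fun l _ => ?_
        split_ifs with hc
        · have hl6 : l < 6 := by
            have : (l : ℝ) < 6 := by
              have : (2 : ℝ) * l < 12 := lt_trans hc.2 hT12
              linarith
            exact_mod_cast this
          have hl1 := hc.1
          interval_cases l
          · rw [v1, rowz 1 (by norm_num)]; ring
          · rw [v2, rowz 2 (by norm_num)]; ring
          · rw [v3, rowz 3 (by norm_num)]; ring
          · rw [row4]; ring
          · rw [v5, rowz 5 (by norm_num)]; ring
        · rfl
      rw [hL]
      exact Finset.sum_nonneg fun h _ => by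
        split_ifs with hc
        · exact mul_nonneg (g0 h) (by linarith [hc.1])
        · exact le_rfl
  ·
    refine decAt_all_of_lowCeiling (a * x) 12 (gate FV[u₀, u₁, u₂, u₃, u₄] a) T hax0 hax1 g0 gM g1 gmean hT0 hta ?_ j' hj'
    intro l hl hlow hpos
    exfalso
    have hl4 : l < 4 := by
      have : (l : ℝ) < 4 := by linarith
      exact_mod_cast this
    interval_cases l
    · rw [v1] at hpos; exact lt_irrefl _ hpos
    · rw [v2] at hpos; exact lt_irrefl _ hpos
    · rw [v3] at hpos; exact lt_irrefl _ hpos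

/-- **THE QUAD HUB IS SDEC.**  For `0 < x`, `1/2 ≤ γᵢ < 1`, `3x ≤ 1 + 2γᵢ` (`i = 1..4`): the law of `4 + 2·#{i : blob i on}` (four far-giant
pieces convolved; atoms `4,6,8,10,12`) is `SDEC x 12` — `sdec_fiveAtom_oneLow` with the elementary symmetric masses and `quadHub_keys`. [this work] -/
theorem sdec_quadHub {x γ₁ γ₂ γ₃ γ₄ : ℝ} (hx0 : 0 < x) (h₁ : 1 / 2 ≤ γ₁) (h₁' : γ₁ < 1) (h₂ : 1 / 2 ≤ γ₂) (h₂' : γ₂ < 1)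
    (h₃ : 1 / 2 ≤ γ₃) (h₃' : γ₃ < 1) (h₄ : 1 / 2 ≤ γ₄) (h₄' : γ₄ < 1)
    (hx₁ : 3 * x ≤ 1 + 2 * γ₁) (hx₂ : 3 * x ≤ 1 + 2 * γ₂) (hx₃ : 3 * x ≤ 1 + 2 * γ₃) (hx₄ : 3 * x ≤ 1 + 2 * γ₄) :
    SDEC x 12 QH[γ₁, γ₂, γ₃, γ₄] := by
  have hx1 : x < 1 := by linarith
  have n₁ : (0 : ℝ) ≤ 1 - γ₁ := by linarith
  have n₂ : (0 : ℝ) ≤ 1 - γ₂ := by linarith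
  have n₃ : (0 : ℝ) ≤ 1 - γ₃ := by linarith
  have n₄ : (0 : ℝ) ≤ 1 - γ₄ := by linarith
  have p₁ : (0 : ℝ) ≤ γ₁ := by linarith
  have p₂ : (0 : ℝ) ≤ γ₂ := by linarith
  have p₃ : (0 : ℝ) ≤ γ₃ := by linarith
  have p₄ : (0 : ℝ) ≤ γ₄ := by linarith
  obtain ⟨key1, key2, key3, key4, key5, key6⟩ := quadHub_keys h₁ h₁'.le h₂ h₂'.le h₃ h₃'.le h₄ h₄'.le hx₁ hx₂ hx₃ hx₄
  have hsum : ((1 - γ₁) * (1 - γ₂) * (1 - γ₃) * (1 - γ₄)) + (γ₁ * (1 - γ₂) * (1 - γ₃) * (1 - γ₄) + (1 - γ₁) * γ₂ * (1 - γ₃) * (1 - γ₄) + (1 - γ₁) * (1 - γ₂) * γ₃ * (1 - γ₄) + (1 - γ₁) * (1 - γ₂) * (1 - γ₃) * γ₄) + (γ₁ * γ₂ * (1 - γ₃) * (1 - γ₄) + γ₁ * (1 - γ₂) * γ₃ * (1 - γ₄) + γ₁ * (1 - γ₂) * (1 - γ₃) * γ₄ + (1 - γ₁) * γ₂ * γ₃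 * (1 - γ₄) + (1 - γ₁) * γ₂ * (1 - γ₃) * γ₄ + (1 - γ₁) * (1 - γ₂) * γ₃ * γ₄) + (γ₁ * γ₂ * γ₃ * (1 - γ₄) + γ₁ * γ₂ * (1 - γ₃) * γ₄ + γ₁ * (1 - γ₂) * γ₃ * γ₄ + (1 - γ₁) * γ₂ * γ₃ * γ₄) + (γ₁ * γ₂ * γ₃ * γ₄) = 1 := by ring
  have hmean : 4 * ((1 - γ₁) * (1 - γ₂) * (1 - γ₃) * (1 - γ₄)) + 6 * (γ₁ * (1 - γ₂) * (1 - γ₃) * (1 - γ₄) + (1 - γ₁) * γ₂ * (1 - γ₃) * (1 - γ₄) + (1 - γ₁) * (1 - γ₂) * γ₃ * (1 - γ₄) + (1 - γ₁) * (1 - γ₂) * (1 - γ₃) * γ₄) + 8 * (γ₁ * γ₂ * (1 - γ₃) * (1 - γ₄) + γ₁ * (1 - γ₂) * γ₃ * (1 - γ₄) + γ₁ * (1 - γ₂) * (1 - γ₃) * γ₄ + (1 - γ₁) * γ₂ * γ₃ * (1 - γ₄) + (1 - γ₁) * γ₂ * (1 - γ₃) * γ₄ + (1 - γ₁) * (1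 - γ₂) * γ₃ * γ₄) + 10 * (γ₁ * γ₂ * γ₃ * (1 - γ₄) + γ₁ * γ₂ * (1 - γ₃) * γ₄ + γ₁ * (1 - γ₂) * γ₃ * γ₄ + (1 - γ₁) * γ₂ * γ₃ * γ₄) + 12 * (γ₁ * γ₂ * γ₃ * γ₄) = 4 + 2 * γ₁ + 2 * γ₂ + 2 * γ₃ + 2 * γ₄ := by
    ring
  exact sdec_fiveAtom_oneLow hx0 hx1 (by positivity) (by positivity) (by positivity) (by positivity) (by positivity) hsum
    (by rw [hmean]; linarith) (by rw [hmean]; linarith) key1 key2 key3 key4 key5 key6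

/-- **FOUR GLUED CHILDREN: the all-far-giant core `C(γ₁)∗C(γ₂)∗C(γ₃)∗C(γ₄)` of the piece expansion is SDEC at every floor `x ≤ min qᵢgᵢ`**
(`mᵢ = qᵢ(1+2gᵢ) ≥ 2`). [this work] -/
theorem sdec_quadHub_glued {x q₁ g₁ q₂ g₂ q₃ g₃ q₄ g₄ : ℝ} (hx0 : 0 < x)
    (hq₁ : 0 < q₁) (hq₁' : q₁ < 1) (hg₁ : 0 < g₁) (hg₁' : g₁ < 1) (hq₂ : 0 < q₂) (hq₂' : q₂ < 1) (hg₂ : 0 < g₂) (hg₂' : g₂ < 1)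
    (hq₃ : 0 < q₃) (hq₃' : q₃ < 1) (hg₃ : 0 < g₃) (hg₃' : g₃ < 1) (hq₄ : 0 < q₄) (hq₄' : q₄ < 1) (hg₄ : 0 < g₄) (hg₄' : g₄ < 1)
    (hm₁ : 2 ≤ q₁ * (1 + 2 * g₁)) (hm₂ : 2 ≤ q₂ * (1 + 2 * g₂)) (hm₃ : 2 ≤ q₃ * (1 + 2 * g₃)) (hm₄ : 2 ≤ q₄ * (1 + 2 * g₄))
    (hx₁ : x ≤ q₁ * g₁) (hx₂ : x ≤ q₂ * g₂) (hx₃ : x ≤ q₃ * g₃) (hx₄ : x ≤ q₄ * g₄) :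
    SDEC x 12 (lconv 9 3 (lconv 6 3 (lconv 3 3 CP[(q₁ * (1 + 2 * g₁) - 1) / 2] CP[(q₂ * (1 + 2 * g₂) - 1) / 2]) CP[(q₃ * (1 + 2 * g₃) - 1) / 2])
      CP[(q₄ * (1 + 2 * g₄) - 1) / 2]) := by
  obtain ⟨a1, a2, a3, _⟩ := gluedChild_piece_facts hq₁ hq₁' hg₁ hg₁' hm₁ hx₁
  obtain ⟨b1, b2, b3, _⟩ := gluedChild_piece_facts hq₂ hq₂' hg₂ hg₂' hm₂ hx₂
  obtain ⟨c1, c2, c3, _⟩ := gluedChild_piece_facts hq₃ hq₃' hg₃ hg₃' hm₃ hx₃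
  obtain ⟨d1, d2, d3, _⟩ := gluedChild_piece_facts hq₄ hq₄' hg₄ hg₄' hm₄ hx₄
  rw [pairHub_eq_lconv, tripleHub_eq_lconv, quadHub_eq_lconv]
  exact sdec_quadHub hx0 a1 a2 b1 b2 c1 c2 d1 d2 a3 b3 c3 d3

end LawDec
end Quant
end Summit.CriticalPhenomena.PercolationContinuityZ3.Theorems
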